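import Mathlib
import Summits.NavierStokesRegularity.NavierStokesRegularity.Theorems.FilamentSkeletonRssKelvinGateSharpLine1AG
import Summits.NavierStokesRegularity.NavierStokesRegularity.Theorems.FilamentSkeletonRssKelvinGateSharpContinuation

/-!
# Route `FilamentSkeletonRss` · LIVE crux `TransverseReduction1AG` (stmt-27853) — line `kelvin_gate_sharp`:
# THE KILL-FIRST STUB AS AN ESTIMATE — `DressedBase1AS → EventualSharpApriori1AS → TransverseReduction1AG`, sorry-free composition

Definitions + theorems (`--supports stmt-NavierStokesRegularity-27853 --as helper`).  HONEST FRAMING: bookkeeping for a HYPOTHETICAL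
filament-type rotating-self-similar blow-up route (refutation side, MODEL rung); nothing here moves Navier–Stokes regularity; the stub
statements below are OPEN (`def … : Prop`, never asserted); `TransverseReduction1AG` is neither proved nor refuted.

Two things are put together.  (1) A GAP in the base specification: `BaseSpec1A` (p639443) records `U⁰ ∈ C²` and `⟨y⟩‖U⁰‖ ≤ C_bΓ^{c_b}`
but not the weighted derivative bounds `⟨y⟩²‖DU⁰‖, ⟨y⟩³‖D²U⁰‖ ≤ C_bΓ^{c_b}` that make the base perturbation `DW[U⁰] + DU⁰[W]` a map
`X♯ → Y♯` (`XSharp.ySharp_perturbation`, p635578) — without them no gate at `U⁰` can be built from the free one.  `BaseSpec1AS` adds exactly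
these two clauses (a genuine dressed base, smooth with self-similar decay, has them; S1 pays, S2 profits).  (2) The continuity method
(`sharp_gate_of_apriori`, p641848): in the sharp scales a gate at `U⁰` EXISTS, with polynomial bound, as soon as the UNIFORM A-PRIORI
BOUND `SharpApriori (3/2) B α₁ (t·U⁰)` holds for `t ∈ [0,1]`.  Hence the line can be cut with the kill-first stub stated as an ESTIMATE:

* S1″ `DressedBase1AS` — as `DressedBase1AG` (A1G skeletons, cone bound (d7) in the hypothesis) with `BaseSpec1AS`;
* S2‴ `EventualSharpApriori1AS` — ∀ box incl. `KA` ∀ `C_b c_b` ∃ `κ B₀ k₀` ∀ `k ≥ k₀` ∀ `C_r` ∃ `Γ₂` ∀ `Γ ≥ Γ₂` ∀ A1G skeleton ∀ base ∈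
  `BaseSpec1AS`: for every `t ∈ [0,1]`, `SharpApriori (3/2) (B₀Γ^κ) α₁ (t·U⁰)` — every sharp solution of `𝓛_(α₁,tU⁰) W + ∇Q = F` obeys
  `‖W‖_{X♯} ≤ B₀Γ^κ ‖F‖_{Y♯}` (uniqueness-with-estimate along the ray of the dressed base: the Kelvin-mode / Liouville statement proper);
* `eventualSharpGate1AS_of_apriori : EventualSharpApriori1AS → EventualSharpGate1AS` (gate bound `(|B₀| + C(1+4|C_b||B₀|))·Γ^{|κ|+|c_b|}`),
  `TransverseReduction1AG_of_sharp1AS : DressedBase1AS → EventualSharpGate1AS → TransverseReduction1AG` (p641137 §3 re-threaded), and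
  **`TransverseReduction1AG_of_apriori : DressedBase1AS → EventualSharpApriori1AS → TransverseReduction1AG`**.
Monotonicity: `dressedBase1AG_of_1AS`, `eventualSharpGate1AS_of_1AG` (the v2 stubs of `Lines/kelvin_gate_sharp_1AG.lean` sit between).
-/

set_option linter.dupNamespace false

noncomputable section

namespace Summit.NavierStokesRegularity.NavierStokesRegularity.Theorems.KelvinGate

open scoped BigOperators Topology InnerProductSpace RealInnerProductSpace ContDiff
open Filter Set Function MeasureTheory
open Literature.Analysis.FluidPDE
open Summit.NavierStokesRegularity.NavierStokesRegularity.Theses.FilamentSkeletonRss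

/-! ## 1. The sharp base specification (derivative bounds added) -/

/-- **Dressed base of order `k`, SHARP form**: `BaseSpec1A k C_b c_b C_r …` AND the weighted derivative bounds
`⟨y⟩²‖DU⁰‖ ≤ C_bΓ^{c_b}`, `⟨y⟩³‖D²U⁰‖ ≤ C_bΓ^{c_b}` (so that `DW[U⁰] + DU⁰[W] : X♯ → Y♯` with radius `4 C_bΓ^{c_b} R`). -/
def BaseSpec1AS (k : ℕ) (Cb cb Cr : ℝ) (N : ℕ) (Γ ρ η Rw : ℝ) (X : Fin N → ℝ → EuclideanSpace ℝ (Fin 3))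
    (u : (Fin N → ℝ → EuclideanSpace ℝ (Fin 3)) → EuclideanSpace ℝ (Fin 3) → EuclideanSpace ℝ (Fin 3))
    (α₁ : ℝ) (U0 : EuclideanSpace ℝ (Fin 3) → EuclideanSpace ℝ (Fin 3)) (P0 : EuclideanSpace ℝ (Fin 3) → ℝ) : Prop :=
  BaseSpec1A k Cb cb Cr N Γ ρ η Rw X u α₁ U0 P0 ∧
  (∀ y, (1 + ‖y‖) ^ 2 * ‖fderiv ℝ U0 y‖ ≤ Cb * Γ ^ cb) ∧ (∀ y, (1 + ‖y‖) ^ 3 * ‖fderiv ℝ (fderiv ℝ U0) y‖ ≤ Cb * Γ ^ cb)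

/-- A sharp dressed base is a dressed base. [folklore] -/
theorem BaseSpec1AS.to1A {k : ℕ} {Cb cb Cr : ℝ} {N : ℕ} {Γ ρ η Rw : ℝ} {X : Fin N → ℝ → EuclideanSpace ℝ (Fin 3)}
    {u : (Fin N → ℝ → EuclideanSpace ℝ (Fin 3)) → EuclideanSpace ℝ (Fin 3) → EuclideanSpace ℝ (Fin 3)} {α₁ : ℝ}
    {U0 : EuclideanSpace ℝ (Fin 3) → EuclideanSpace ℝ (Fin 3)} {P0 : EuclideanSpace ℝ (Fin 3) → ℝ}
    (h : BaseSpec1AS k Cb cb Cr N Γ ρ η Rw X u α₁ U0 P0) : BaseSpec1A k Cb cb Cr N Γ ρ η Rw X u α₁ U0 P0 :=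
  h.1

/-! ## 2. The stubs of the estimate-form line (as `Prop`s; never asserted here) -/

/-- Statement of stub S1″ · `DressedBase1AS` (size L/XL): as `DressedBase1AG` (A1G skeletons only; cone bound (d7) in the hypothesis), but
delivering a SHARP dressed base `BaseSpec1AS` (weighted bounds for `U⁰, DU⁰, D²U⁰`). -/
def DressedBase1AS : Prop :=
  ∀ (N:ℕ) (δ ρ K Λ a b cnd η Rw Rb cg θ₀ KA:ℝ), 0 < N → 0 < δ → 0 < ρ → 0 ≤ a → 0 < η → 0 < Rw → 0 < Rb → 0 < cg → 0 < θ₀ →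
    ∃ Cb cb : ℝ, ∀ k : ℕ, ∃ Cr Γ₁ : ℝ, ∀ Γ:ℝ, Γ₁≤Γ → ∀ (γ:Fin N → ℝ) (α:ℝ) (X:Fin N → ℝ → EuclideanSpace ℝ (Fin 3)) (w:Fin N → ℝ → ℝ) (c:Fin N → ℝ)
      (m n:Fin N → EuclideanSpace ℝ (Fin 3)) (Aa:Fin N → ℝ → ℝ) (u:(Fin N → ℝ → EuclideanSpace ℝ (Fin 3)) → EuclideanSpace ℝ (Fin 3) → EuclideanSpace ℝ (Fin 3))
      (v:EuclideanSpace ℝ (Fin 3) → EuclideanSpace ℝ (Fin 3)) (A:Fin N → (EuclideanSpace ℝ (Fin 3) →L[ℝ] EuclideanSpace ℝ (Fin 3)))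
      (T:(Fin N → ℝ → EuclideanSpace ℝ (Fin 3)) → Fin N → ℝ → EuclideanSpace ℝ (Fin 3)),
      DefU1A N Γ γ Aa u → DefV1A N α X u v → DefA1A N X c v A → DefT1A N α u T →
      Clauses1AG N Γ δ ρ K Λ a b cnd Rw Rb cg θ₀ KA γ α X w c m n Aa v A T →
      ∃ (α₁ : ℝ) (U0 : EuclideanSpace ℝ (Fin 3) → EuclideanSpace ℝ (Fin 3)) (P0 : EuclideanSpace ℝ (Fin 3) → ℝ),
        BaseSpec1AS k Cb cb Cr N Γ ρ η Rw X u α₁ U0 P0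

/-- Statement of stub S2″ · `EventualSharpGate1AS` (size XL): as `EventualSharpGate1AG`, but only around SHARP dressed bases (`BaseSpec1AS`). -/
def EventualSharpGate1AS : Prop :=
  ∀ (N:ℕ) (δ ρ K Λ a b cnd η Rw Rb cg θ₀ KA:ℝ), 0 < N → 0 < δ → 0 < ρ → 0 ≤ a → 0 < η → 0 < Rw → 0 < Rb → 0 < cg → 0 < θ₀ →
    ∀ Cb cb : ℝ, ∃ κ A₀ : ℝ, ∃ k₀ : ℕ, ∀ k : ℕ, k₀ ≤ k → ∀ Cr : ℝ, ∃ Γ₂ : ℝ, ∀ Γ:ℝ, Γ₂≤Γ →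
      ∀ (γ:Fin N → ℝ) (α:ℝ) (X:Fin N → ℝ → EuclideanSpace ℝ (Fin 3)) (w:Fin N → ℝ → ℝ) (c:Fin N → ℝ)
      (m n:Fin N → EuclideanSpace ℝ (Fin 3)) (Aa:Fin N → ℝ → ℝ) (u:(Fin N → ℝ → EuclideanSpace ℝ (Fin 3)) → EuclideanSpace ℝ (Fin 3) → EuclideanSpace ℝ (Fin 3))
      (v:EuclideanSpace ℝ (Fin 3) → EuclideanSpace ℝ (Fin 3)) (A:Fin N → (EuclideanSpace ℝ (Fin 3) →L[ℝ] EuclideanSpace ℝ (Fin 3)))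
      (T:(Fin N → ℝ → EuclideanSpace ℝ (Fin 3)) → Fin N → ℝ → EuclideanSpace ℝ (Fin 3)),
      DefU1A N Γ γ Aa u → DefV1A N α X u v → DefA1A N X c v A → DefT1A N α u T →
      Clauses1AG N Γ δ ρ K Λ a b cnd Rw Rb cg θ₀ KA γ α X w c m n Aa v A T →
      ∀ (α₁ : ℝ) (U0 : EuclideanSpace ℝ (Fin 3) → EuclideanSpace ℝ (Fin 3)) (P0 : EuclideanSpace ℝ (Fin 3) → ℝ),
        BaseSpec1AS k Cb cb Cr N Γ ρ η Rw X u α₁ U0 P0 →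
        ∃ (K : (EuclideanSpace ℝ (Fin 3) → EuclideanSpace ℝ (Fin 3)) → EuclideanSpace ℝ (Fin 3) → EuclideanSpace ℝ (Fin 3))
          (𝒬 : (EuclideanSpace ℝ (Fin 3) → EuclideanSpace ℝ (Fin 3)) → EuclideanSpace ℝ (Fin 3) → ℝ),
          SharpGateSpec (3/2:ℝ) (A₀ * Γ ^ κ) α₁ U0 K 𝒬

/-- Statement of stub S2‴ · `EventualSharpApriori1AS` (size XL; KILL-FIRST — the crux of the line AS AN ESTIMATE): for all box constants
incl. `KA` and size constants `C_b, c_b` there are `κ, B₀, k₀` such that for `k ≥ k₀`, every `C_r`, `Γ ≥ Γ₂`, every A1G skeleton and every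
sharp dressed base `(α₁, U⁰, P⁰) ∈ BaseSpec1AS`: along the whole ray `t·U⁰`, `t ∈ [0,1]`, the UNIFORM A-PRIORI BOUND
`SharpApriori (3/2) (B₀Γ^κ) α₁ (t·U⁰)` holds — every sharp solution `(W, Q)` of `𝓛_(α₁, tU⁰) W + ∇Q = F` with `F ∈ Y♯_{3/2}(R)` has
`W ∈ X♯_{3/2}(B₀Γ^κ R)` (in particular `F = 0 ⇒ W = 0`: no neutral Kelvin mode in the sharp class, quantitatively, uniformly on the ray). -/
def EventualSharpApriori1AS : Prop :=
  ∀ (N:ℕ) (δ ρ K Λ a b cnd η Rw Rb cg θ₀ KA:ℝ), 0 < N → 0 < δ → 0 < ρ → 0 ≤ a → 0 < η → 0 < Rw → 0 < Rb → 0 < cg → 0 < θ₀ →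
    ∀ Cb cb : ℝ, ∃ κ B₀ : ℝ, ∃ k₀ : ℕ, ∀ k : ℕ, k₀ ≤ k → ∀ Cr : ℝ, ∃ Γ₂ : ℝ, ∀ Γ:ℝ, Γ₂≤Γ →
      ∀ (γ:Fin N → ℝ) (α:ℝ) (X:Fin N → ℝ → EuclideanSpace ℝ (Fin 3)) (w:Fin N → ℝ → ℝ) (c:Fin N → ℝ)
      (m n:Fin N → EuclideanSpace ℝ (Fin 3)) (Aa:Fin N → ℝ → ℝ) (u:(Fin N → ℝ → EuclideanSpace ℝ (Fin 3)) → EuclideanSpace ℝ (Fin 3) → EuclideanSpace ℝ (Fin 3))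
      (v:EuclideanSpace ℝ (Fin 3) → EuclideanSpace ℝ (Fin 3)) (A:Fin N → (EuclideanSpace ℝ (Fin 3) →L[ℝ] EuclideanSpace ℝ (Fin 3)))
      (T:(Fin N → ℝ → EuclideanSpace ℝ (Fin 3)) → Fin N → ℝ → EuclideanSpace ℝ (Fin 3)),
      DefU1A N Γ γ Aa u → DefV1A N α X u v → DefA1A N X c v A → DefT1A N α u T →
      Clauses1AG N Γ δ ρ K Λ a b cnd Rw Rb cg θ₀ KA γ α X w c m n Aa v A T →
      ∀ (α₁ : ℝ) (U0 : EuclideanSpace ℝ (Fin 3) → EuclideanSpace ℝ (Fin 3)) (P0 : EuclideanSpace ℝ (Fin 3) → ℝ),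
        BaseSpec1AS k Cb cb Cr N Γ ρ η Rw X u α₁ U0 P0 →
        ∀ t ∈ Set.Icc (0:ℝ) 1, SharpApriori (3/2:ℝ) (B₀ * Γ ^ κ) α₁ (fun z => t • U0 z)

/-- Monotonicity: a sharp dressing is a dressing (`DressedBase1AS → DressedBase1AG`). [folklore] -/
theorem dressedBase1AG_of_1AS (h : DressedBase1AS) : DressedBase1AG := by
  intro N δ ρ K Λ a b cnd η Rw Rb cg θ₀ KA hN hδ hρ ha hη hRw hRb hcg hθ₀
  obtain ⟨Cb, cb, hS⟩ := h N δ ρ K Λ a b cnd η Rw Rb cg θ₀ KA hN hδ hρ ha hη hRw hRb hcg hθ₀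
  refine ⟨Cb, cb, fun k => ?_⟩
  obtain ⟨Cr, Γ₁, hS'⟩ := hS k
  refine ⟨Cr, Γ₁, fun Γ hΓ γ α X w c m n Aa u v A T hu hv hA hT hcl => ?_⟩
  obtain ⟨α₁, U0, P0, hb⟩ := hS' Γ hΓ γ α X w c m n Aa u v A T hu hv hA hT hcl
  exact ⟨α₁, U0, P0, hb.to1A⟩

/-- Monotonicity: a gate around every dressed base is one around every sharp dressed base (`EventualSharpGate1AG → EventualSharpGate1AS`). [folklore] -/
theorem eventualSharpGate1AS_of_1AG (h : EventualSharpGate1AG) : EventualSharpGate1AS := by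
  intro N δ ρ K Λ a b cnd η Rw Rb cg θ₀ KA hN hδ hρ ha hη hRw hRb hcg hθ₀ Cb cb
  obtain ⟨κ, A₀, k₀, hS⟩ := h N δ ρ K Λ a b cnd η Rw Rb cg θ₀ KA hN hδ hρ ha hη hRw hRb hcg hθ₀ Cb cb
  refine ⟨κ, A₀, k₀, fun k hk Cr => ?_⟩
  obtain ⟨Γ₂, hS'⟩ := hS k hk Cr
  exact ⟨Γ₂, fun Γ hΓ γ α X w c m n Aa u v A T hu hv hA hT hcl α₁ U0 P0 hb =>
    hS' Γ hΓ γ α X w c m n Aa u v A T hu hv hA hT hcl α₁ U0 P0 hb.to1A⟩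

/-! ## 3. The a-priori bound is monotone; the estimate stub gives the gate stub -/

/-- `SharpApriori` is monotone in its constant. -/
theorem SharpApriori.mono {a B B' α : ℝ} {U : EuclideanSpace ℝ (Fin 3) → EuclideanSpace ℝ (Fin 3)}
    (h : SharpApriori a B α U) (hB : B ≤ B') : SharpApriori a B' α U := by
  intro W Q F R hW hdiv hQ hQb hF heq
  exact (h W Q F R hW hdiv hQ hQb hF heq).mono (mul_le_mul_of_nonneg_right hB hF.nonneg)

/-- Polynomial bookkeeping for the gate bound: for `Γ ≥ 1`, `C ≥ 0`, `M ≤ |C_b| Γ^{c_b}`: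
`max (|B₀|Γ^κ) (C (1 + 4 M (|B₀|Γ^κ))) ≤ (|B₀| + C (1 + 4|C_b||B₀|)) Γ^{|κ|+|c_b|}`. -/
theorem gate_bound_poly {Γ C Cb cb B₀ κ M : ℝ} (hΓ : 1 ≤ Γ) (hC : 0 ≤ C) (hM : M ≤ |Cb| * Γ ^ cb) :
    max (|B₀| * Γ ^ κ) (C * (1 + 4 * M * (|B₀| * Γ ^ κ))) ≤ (|B₀| + C * (1 + 4 * |Cb| * |B₀|)) * Γ ^ (|κ| + |cb|) := by
  have hΓ0 : 0 < Γ := by linarith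
  have hκ : Γ ^ κ ≤ Γ ^ (|κ| + |cb|) := Real.rpow_le_rpow_of_exponent_le hΓ ((le_abs_self κ).trans (by linarith [abs_nonneg cb]))
  have hcb : Γ ^ cb ≤ Γ ^ |cb| := Real.rpow_le_rpow_of_exponent_le hΓ (le_abs_self cb)
  have hκ' : Γ ^ κ ≤ Γ ^ |κ| := Real.rpow_le_rpow_of_exponent_le hΓ (le_abs_self κ)
  have h1 : (1:ℝ) ≤ Γ ^ (|κ| + |cb|) := Real.one_le_rpow hΓ (by positivity)
  have hprod : Γ ^ |cb| * Γ ^ |κ| = Γ ^ (|κ| + |cb|) := by rw [← Real.rpow_add hΓ0, add_comm]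
  have hB : 0 ≤ |B₀| * Γ ^ (|κ| + |cb|) := by positivity
  have hMB : M * (|B₀| * Γ ^ κ) ≤ |Cb| * |B₀| * Γ ^ (|κ| + |cb|) := by
    calc M * (|B₀| * Γ ^ κ) ≤ (|Cb| * Γ ^ cb) * (|B₀| * Γ ^ |κ|) :=
          mul_le_mul hM (mul_le_mul_of_nonneg_left hκ' (abs_nonneg _)) (by positivity) (by positivity)
      _ ≤ (|Cb| * Γ ^ |cb|) * (|B₀| * Γ ^ |κ|) :=
          mul_le_mul_of_nonneg_right (mul_le_mul_of_nonneg_left hcb (abs_nonneg _)) (by positivity)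
      _ = |Cb| * |B₀| * (Γ ^ |cb| * Γ ^ |κ|) := by ring
      _ = |Cb| * |B₀| * Γ ^ (|κ| + |cb|) := by rw [hprod]
  refine max_le ?_ ?_
  · calc |B₀| * Γ ^ κ ≤ |B₀| * Γ ^ (|κ| + |cb|) := mul_le_mul_of_nonneg_left hκ (abs_nonneg _)
      _ ≤ (|B₀| + C * (1 + 4 * |Cb| * |B₀|)) * Γ ^ (|κ| + |cb|) := by
          apply mul_le_mul_of_nonneg_right _ (by positivity)
          have : 0 ≤ C * (1 + 4 * |Cb| * |B₀|) := by positivity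
          linarith
  · calc C * (1 + 4 * M * (|B₀| * Γ ^ κ)) = C * 1 + 4 * C * (M * (|B₀| * Γ ^ κ)) := by ring
      _ ≤ C * Γ ^ (|κ| + |cb|) + 4 * C * (|Cb| * |B₀| * Γ ^ (|κ| + |cb|)) :=
          add_le_add (mul_le_mul_of_nonneg_left h1 hC) (mul_le_mul_of_nonneg_left hMB (by positivity))
      _ = C * (1 + 4 * |Cb| * |B₀|) * Γ ^ (|κ| + |cb|) := by ring
      _ ≤ (|B₀| + C * (1 + 4 * |Cb| * |B₀|)) * Γ ^ (|κ| + |cb|) := by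
          apply mul_le_mul_of_nonneg_right _ (by positivity)
          linarith [abs_nonneg B₀]

/-- **THE ESTIMATE GIVES THE GATE (stub level).**  `EventualSharpApriori1AS → EventualSharpGate1AS`: around every sharp dressed base, the
uniform a-priori bound along the ray `t·U⁰` yields — by the continuity method from the free gate (`sharp_gate_of_apriori`, `a = 3/2`) —
a sharp Kelvin gate with the polynomial bound `(|B₀| + C(1 + 4|C_b||B₀|))·Γ^{|κ|+|c_b|}` (`C = C(3/2)` the free gate's constant). -/
theorem eventualSharpGate1AS_of_apriori (h : EventualSharpApriori1AS) : EventualSharpGate1AS := by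
  obtain ⟨C, hC0, hcont⟩ := sharp_gate_of_apriori (a := (3/2:ℝ)) (by norm_num) (by norm_num)
  intro N δ ρ K Λ a b cnd η Rw Rb cg θ₀ KA hN hδ hρ ha hη hRw hRb hcg hθ₀ Cb cb
  obtain ⟨κ, B₀, k₀, hS⟩ := h N δ ρ K Λ a b cnd η Rw Rb cg θ₀ KA hN hδ hρ ha hη hRw hRb hcg hθ₀ Cb cb
  refine ⟨|κ| + |cb|, |B₀| + C * (1 + 4 * |Cb| * |B₀|), k₀, fun k hk Cr => ?_⟩
  obtain ⟨Γ₂, hS'⟩ := hS k hk Cr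
  refine ⟨max Γ₂ 1, fun Γ hΓ γ α X w c m n Aa u v A T hu hv hA hT hcl α₁ U0 P0 hb => ?_⟩
  have hΓ₂ : Γ₂ ≤ Γ := le_trans (le_max_left _ _) hΓ
  have hΓ1 : 1 ≤ Γ := le_trans (le_max_right _ _) hΓ
  have hΓ0 : 0 < Γ := by linarith
  have hap := hS' Γ hΓ₂ γ α X w c m n Aa u v A T hu hv hA hT hcl α₁ U0 P0 hb
  obtain ⟨⟨_, hU0, _, _, hU0b, _, _, _, _⟩, hU1b, hU2b⟩ := hb
  -- the a-priori bound with the nonnegative constant `|B₀| Γ^κ`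
  have hBnn : 0 ≤ |B₀| * Γ ^ κ := by positivity
  have hap' : ∀ t ∈ Set.Icc (0:ℝ) 1, SharpApriori (3/2:ℝ) (|B₀| * Γ ^ κ) α₁ (fun z => t • U0 z) := fun t ht =>
    (hap t ht).mono (mul_le_mul_of_nonneg_right (le_abs_self B₀) (Real.rpow_nonneg hΓ0.le κ))
  obtain ⟨Kop, Qop, hgate⟩ := hcont α₁ (|B₀| * Γ ^ κ) (Cb * Γ ^ cb) U0 hBnn hU0 hU0b hU1b hU2b hap'
  refine ⟨Kop, Qop, hgate.mono ?_⟩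
  have hM : Cb * Γ ^ cb ≤ |Cb| * Γ ^ cb := mul_le_mul_of_nonneg_right (le_abs_self Cb) (Real.rpow_nonneg hΓ0.le cb)
  exact gate_bound_poly hΓ1 hC0 hM

/-! ## 4. Compositions: the estimate-form line concludes the live crux BY NAME -/

/-- **Composition over sharp dressed bases.**  `DressedBase1AS → EventualSharpGate1AS → TransverseReduction1AG` (the §3 proof of p641137 with
`BaseSpec1AS.to1A` inserted before `concl1A_of_base_gate`). -/
theorem TransverseReduction1AG_of_sharp1AS (h1 : DressedBase1AS) (h2 : EventualSharpGate1AS) : TransverseReduction1AG := by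
  refine transverseReduction1AG_iff.mpr ?_
  intro N δ ρ K Λ a b cnd η Rw Rb cg θ₀ KA hN hδ hρ ha hη hRw hRb hcg hθ₀
  obtain ⟨Cb, cb, hS1⟩ := h1 N δ ρ K Λ a b cnd η Rw Rb cg θ₀ KA hN hδ hρ ha hη hRw hRb hcg hθ₀
  obtain ⟨κ, A₀, k₀, hS2⟩ := h2 N δ ρ K Λ a b cnd η Rw Rb cg θ₀ KA hN hδ hρ ha hη hRw hRb hcg hθ₀ Cb cb
  set k : ℕ := max k₀ (⌈2 * κ⌉₊ + 1) with hk
  have hk₀ : k₀ ≤ k := le_max_left _ _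
  have hk1 : 1 ≤ k := le_trans (Nat.le_add_left 1 _) (le_max_right _ _)
  have hk2 : 2 * κ + 1 ≤ (k : ℝ) := by
    have h1 : (⌈2 * κ⌉₊ : ℝ) + 1 ≤ (k : ℝ) := by
      have : ((⌈2 * κ⌉₊ + 1 : ℕ) : ℝ) ≤ (k : ℝ) := by exact_mod_cast le_max_right k₀ (⌈2 * κ⌉₊ + 1)
      push_cast at this; exact this
    linarith [Nat.le_ceil (2 * κ)]
  obtain ⟨Cr, Γ₁, hS1'⟩ := hS1 k
  obtain ⟨Γ₂, hS2'⟩ := hS2 k hk₀ Cr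
  set Γ₃ : ℝ := max 1 (16 * A₀ ^ 2 * |Cr| + 4 * |A₀| * |Cr| + 8 * |A₀| * |Cr| / η + 1) with hΓ₃
  refine ⟨max (max Γ₁ Γ₂) Γ₃, ?_⟩
  intro Γ hΓ γ α X w c m n Aa u v A T hu hv hA hT hcl
  have hΓ₁ : Γ₁ ≤ Γ := le_trans (le_trans (le_max_left _ _) (le_max_left _ _)) hΓ
  have hΓ₂ : Γ₂ ≤ Γ := le_trans (le_trans (le_max_right _ _) (le_max_left _ _)) hΓ
  have hΓ₃' : Γ₃ ≤ Γ := le_trans (le_max_right _ _) hΓ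
  have hΓ1 : 1 ≤ Γ := le_trans (le_max_left _ _) hΓ₃'
  have hΓbig : 16 * A₀ ^ 2 * |Cr| + 4 * |A₀| * |Cr| + 8 * |A₀| * |Cr| / η + 1 ≤ Γ := le_trans (le_max_right _ _) hΓ₃'
  have hΓ0 : 0 < Γ := by linarith
  obtain ⟨α₁, U0, P0, hbaseS⟩ := hS1' Γ hΓ₁ γ α X w c m n Aa u v A T hu hv hA hT hcl
  obtain ⟨Kop, Qop, hgate⟩ := hS2' Γ hΓ₂ γ α X w c m n Aa u v A T hu hv hA hT hcl α₁ U0 P0 hbaseS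
  have hbase := hbaseS.to1A
  -- thresholds (verbatim from `TransverseReduction1AG_of_sharp1AG`)
  obtain ⟨ht1, ht2⟩ := rpow_gate_threshold (κ := κ) hΓ1 hk2 hk1
  have hCr : Cr ≤ |Cr| := le_abs_self Cr
  have hΓκ : 0 ≤ Γ ^ κ := Real.rpow_nonneg hΓ0.le κ
  have hΓk : 0 ≤ Γ ^ (-(k:ℝ)) := Real.rpow_nonneg hΓ0.le _
  have hnn1 : 0 ≤ 16 * A₀ ^ 2 * |Cr| := by positivity
  have hnn2 : 0 ≤ 4 * |A₀| * |Cr| := by positivity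
  have hnn3 : 0 ≤ 8 * |A₀| * |Cr| / η := by positivity
  have hACr : A₀ * Cr ≤ |A₀| * |Cr| := by rw [← abs_mul]; exact le_abs_self _
  have h16 : 16 * (A₀ * Γ ^ κ) ^ 2 * (Cr * Γ ^ (-(k:ℝ))) ≤ 1 := by
    have e : 16 * (A₀ * Γ ^ κ) ^ 2 * (Cr * Γ ^ (-(k:ℝ))) = 16 * A₀ ^ 2 * Cr * ((Γ ^ κ) ^ 2 * Γ ^ (-(k:ℝ))) := by ring
    rw [e]
    have h1 : 16 * A₀ ^ 2 * Cr * ((Γ ^ κ) ^ 2 * Γ ^ (-(k:ℝ))) ≤ 16 * A₀ ^ 2 * Cr * Γ⁻¹ := by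
      have hCr0 : 0 ≤ Cr := by
        have : 0 < Γ ^ (-(k:ℝ)) := Real.rpow_pos_of_pos hΓ0 _
        have hε0 : 0 ≤ Cr * Γ ^ (-(k:ℝ)) := hbase.2.2.2.2.2.2.1.nonneg
        nlinarith
      exact mul_le_mul_of_nonneg_left ht1 (by positivity)
    have h3 : 16 * A₀ ^ 2 * Cr ≤ Γ := by
      have : 16 * A₀ ^ 2 * Cr ≤ 16 * A₀ ^ 2 * |Cr| := mul_le_mul_of_nonneg_left hCr (by positivity)
      linarith
    have h2 : 16 * A₀ ^ 2 * Cr * Γ⁻¹ ≤ 1 := by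
      rw [show 16 * A₀ ^ 2 * Cr * Γ⁻¹ = (16 * A₀ ^ 2 * Cr) / Γ by rw [div_eq_mul_inv], div_le_one hΓ0]
      exact h3
    exact h1.trans h2
  have h2Aε : 2 * (A₀ * Γ ^ κ) * (Cr * Γ ^ (-(k:ℝ))) ≤ 2 * |A₀| * |Cr| * Γ⁻¹ := by
    have e : 2 * (A₀ * Γ ^ κ) * (Cr * Γ ^ (-(k:ℝ))) = 2 * (A₀ * Cr) * (Γ ^ κ * Γ ^ (-(k:ℝ))) := by ring
    rw [e]
    have h1 : 2 * (A₀ * Cr) * (Γ ^ κ * Γ ^ (-(k:ℝ))) ≤ 2 * (|A₀| * |Cr|) * (Γ ^ κ * Γ ^ (-(k:ℝ))) :=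
      mul_le_mul_of_nonneg_right (mul_le_mul_of_nonneg_left hACr (by norm_num)) (mul_nonneg hΓκ hΓk)
    calc _ ≤ 2 * (|A₀| * |Cr|) * (Γ ^ κ * Γ ^ (-(k:ℝ))) := h1
      _ ≤ 2 * (|A₀| * |Cr|) * Γ⁻¹ := mul_le_mul_of_nonneg_left ht2 (by positivity)
      _ = 2 * |A₀| * |Cr| * Γ⁻¹ := by ring
  have hdivΓ : 2 * |A₀| * |Cr| * Γ⁻¹ = (2 * |A₀| * |Cr|) / Γ := by rw [div_eq_mul_inv]
  have hhalf : 2 * (A₀ * Γ ^ κ) * (Cr * Γ ^ (-(k:ℝ))) ≤ 1 / 2 := by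
    refine h2Aε.trans ?_
    rw [hdivΓ, div_le_iff₀ hΓ0]
    linarith
  have hηΓ : 2 * (A₀ * Γ ^ κ) * (Cr * Γ ^ (-(k:ℝ))) ≤ η * √Γ / 2 := by
    refine h2Aε.trans ?_
    have hsqrt : 1 ≤ √Γ := by rw [show (1:ℝ) = √1 by simp]; exact Real.sqrt_le_sqrt hΓ1
    have h1 : 2 * |A₀| * |Cr| * Γ⁻¹ ≤ η / 2 := by
      rw [hdivΓ, div_le_iff₀ hΓ0]
      have e : 8 * |A₀| * |Cr| / η * η = 8 * |A₀| * |Cr| := div_mul_cancel₀ _ hη.ne'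
      have h4 : 8 * |A₀| * |Cr| / η ≤ Γ := by linarith
      have h5 : 8 * |A₀| * |Cr| ≤ η * Γ := by
        calc 8 * |A₀| * |Cr| = 8 * |A₀| * |Cr| / η * η := e.symm
          _ ≤ Γ * η := mul_le_mul_of_nonneg_right h4 hη.le
          _ = η * Γ := mul_comm _ _
      linarith
    calc 2 * |A₀| * |Cr| * Γ⁻¹ ≤ η / 2 := h1
      _ = η * 1 / 2 := by ring
      _ ≤ η * √Γ / 2 := by gcongr
  obtain ⟨C₀, M, U, P, hconcl⟩ := concl1A_of_base_gate hbase hgate h16 hhalf hηΓ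
  exact ⟨α₁, C₀, M, U, P, hconcl⟩

/-- **THE ESTIMATE-FORM LINE, sorry-free composition.**  Sharp dressing of A1G skeletons (S1″) + the uniform a-priori bound along the ray of
every dressed base (S2‴) give the LIVE crux `TransverseReduction1AG` BY NAME — gate by the continuity method, closing and smoothing by
`SharpGateSpec.closing_smooth`. -/
theorem TransverseReduction1AG_of_apriori (h1 : DressedBase1AS) (h2 : EventualSharpApriori1AS) : TransverseReduction1AG :=
  TransverseReduction1AG_of_sharp1AS h1 (eventualSharpGate1AS_of_apriori h2)

end Summit.NavierStokesRegularity.NavierStokesRegularity.Theorems.KelvinGate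

end
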